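import Summits.Ventures.YMGap.YM3IR.ForestTransport

/-!
# YM3IR / ForestWitness — `IRConjecture3` holds for the forest family iff the lattice mass gap holds (kernel proof)

HONEST FRAMING.  This file closes, in the kernel, the cell's track-Y4 STRENGTH AUDIT of the one conjecture-labelled
hypothesis `IRConjecture3 B r ρ I C_b κ` of the §Y4 sentence `massGap3Cofinal_su2_balaban_of_irConjecture3`
(`YM3IR/BalabanSU2.lean`, theory-1).  RESULT (`su2_irConjecture3_iff_massGap3Cofinal`): on Y2's certified SU(2) row, for
every unbounded coupling set `I`, `(∃ C_b κ > 0, IRConjecture3 …) ↔ MassGap3Cofinal I suFrobDist ρ_fund` — with its two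
bookkeeping constants existential, the hypothesis is EQUIVALENT to the conclusion.  READ IT CORRECTLY: this is NOT a proof
of a mass gap, NOT a continuum statement, NOT a renormalisation-group result and NOT evidence for or against Bałaban's
programme; it says that, AS TYPED, `IRConjecture3` is a certified DICTIONARY for the lattice mass gap (uniform clustering
at physical rate `m₀/β` on the cofinal tori), not a reduction of it — the cell's honest label (lead R196, audit F1).  The
witness is the FOREST family (star decimation, `ForestAudit.lean`), for which clause (a) is Haar exactness
(`ForestHaar.lean`), clause (b)(ii) is disintegration along a gauge forest (`ForestQuasiLocality.lean`) and clause (b)(i)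
— conditional covariance decay given the forest — is the fine theory's OWN clustering transported through the leaf
rotation (`forest_clause_i` below).  The forest map is NOT gauge-covariant (theory-1's `CovariantFamily.lean`): for
covariant (Bałaban-type) block maps clause (b) is a genuine statement about loop-carrying constrained conditional laws, and
the reverse implication proved here says nothing about them.

CONTENT.
* `forest_clause_i` — clause (b)(i) on one torus `b·M` from `ClustersWith r (wilsonMeasure …) A m`:
  `|E[fg | σ(forest)] − E[f|·]E[g|·]| ≤ 9 A e^{4m} (Σ δf)(Σ δg) e^{−m n}` a.s. (`ForestTransport.lean` bookkeeping).
* `forestFamily_fluctuationDecouplingAt` — both conjuncts of `FluctuationDecouplingAt r ρ (forestFamily b hb) β κ` from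
  clustering of the fine laws on all tori `b(β)·M`, any `κ ≤ m·b(β)`.
* `forestWitness3_ballFR : ForestWitness3 (ballOfRobustBallFR N ε₀ ε₁ rFR β⋆) r ρ_fund` for every bounded bi-invariant
  symmetric link weight with `r a a = 0` and the triangle inequality (block factor `b(β) = b_T(β)·max(3, ⌈β/b_T(β)⌉)`,
  `C_b ↦ 4 C_b + 1`, `κ = m₀`); `irConjecture3_iff_massGap3Cofinal_ballFR`; the Frobenius-distance facts
  `suFrobDist_mul_left/right`, `suFrobDist_triangle`; and the SU(2) sentence `su2_irConjecture3_iff_massGap3Cofinal`.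
WHY THIS IS NOVEL (cell rule (viii)): a kernel-certified equivalence between a Bałaban-style «enters the cluster domain +
fluctuation decoupling» infrared hypothesis, as actually typed for the paper, and the lattice mass gap it was meant to imply —
an audit result that fixes the paper's honest framing; no such formal statement is in print.

## References
* T. Bałaban, Ultraviolet stability of three-dimensional lattice pure gauge field theories, Commun. Math. Phys. 102 (1985)
  255–275, §1, displays (1)–(6) pp. 256–257 (the block-spin renormalisation set-up the hypothesis abstracts; Lean transcription:
  modules `Literature.MathematicalPhysics.QuantumFieldTheory.Balaban1985CMP102.*`). [cite: Balaban1985UV3, §1 (1)–(6) pp.256–257]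
* H. Föllmer, *Random fields and diffusion processes*, Saint-Flour XV–XVII (1988), Ch. I Remark (2.17). [cite: Follmer1988]
* M. Creutz, *Quarks, Gluons and Lattices* (1983), eq. (9.19) (axial/tree gauge).
-/

noncomputable section

open MeasureTheory ProbabilityTheory
open Literature.MathematicalPhysics.QuantumLattice Literature.MathematicalPhysics.QuantumFieldTheory
open Literature.Probability.LatticeModels Literature.Probability.LatticeModels.DobrushinMetric

namespace Summit.Ventures.YMGap.YM3IR

section ForestDecay

variable {G : Type} [Group G] {b M : ℕ} {r : G → G → ℝ} [NeZero M]

section AnalysisB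

variable [MeasurableSpace G] {N : ℕ} [TopologicalSpace G] [IsTopologicalGroup G] [BorelSpace G]
  [SecondCountableTopology G] [CompactSpace G]

/-- **CLAUSE (b)(i) OF `IRConjecture3` FOR THE FOREST = THE FINE THEORY'S OWN CLUSTERING, TRANSPORTED** (one torus of side
`b·M`, `2 ≤ b`).  If the Wilson law clusters at rate `m ≥ 0` with constant `A ≥ 0` in the link metric `r`
(`ClustersWith`, Y2's currency), then for bounded measurable cylinder observables `f, g` with supports at torus separation
`≥ n`: `|E[fg | σ(forest)] − E[f | ·] E[g | ·]| ≤ 9 A e^{4m} (Σ δf)(Σ δg) e^{−m n}` a.s. — the conditional covariance given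
the forest is the plain covariance of the pulled-back observables (`forestCov_eq_covariance_fixPull`), whose supports grow
by torus distance `≤ 2` each (`fixSupport_separated`) and whose loads grow by a factor `≤ 3` (`sum_fixLoad_le`).  No RG content.
[folklore] -/
theorem forest_clause_i (ρ : G →* Matrix (Fin N) (Fin N) ℂ) (hρ : Continuous ρ) (hb : 2 ≤ b) [NeZero (b * M)] (β : ℝ)
    (hmulL : ∀ g a a' : G, r (g * a) (g * a') = r a a') (hmulR : ∀ g a a' : G, r (a * g) (a' * g) = r a a')
    (hsymm : ∀ a a' : G, r a a' = r a' a) (hself : ∀ a : G, r a a = 0)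
    (htri : ∀ a a' a'' : G, r a a'' ≤ r a a' + r a' a'') {A m : ℝ} (hA : 0 ≤ A) (hm : 0 ≤ m)
    (hcl : ClustersWith r (wilsonMeasure (d := 3) (L := b * M) ρ β) A m)
    {f g : GaugeConfig 3 (b * M) G → ℝ} {Δf Δg : Finset (Edge 3 (b * M))} {δf δg : Edge 3 (b * M) → ℝ} {n : ℕ}
    (hfm : Measurable f) (hgm : Measurable g) (hdepf : DependsOn f (↑Δf : Set (Edge 3 (b * M))))
    (hdepg : DependsOn g (↑Δg : Set (Edge 3 (b * M)))) (hbdf : ∃ C, ∀ U, |f U| ≤ C) (hbdg : ∃ C, ∀ U, |g U| ≤ C)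
    (hδf : IsLipBound r f δf) (hδg : IsLipBound r g δg)
    (hsep : ∀ x ∈ Δf, ∀ y ∈ Δg, n ≤ Literature.MathematicalPhysics.QuantumFieldTheory.torusNorm (x.1 - y.1)) :
    ∀ᵐ U ∂(wilsonMeasure (d := 3) (L := b * M) ρ β),
      |condExp (MeasurableSpace.comap (starDecimation (G := G) b M) inferInstance)
            (wilsonMeasure (d := 3) (L := b * M) ρ β) (fun U => f U * g U) U
          - condExp (MeasurableSpace.comap (starDecimation (G := G) b M) inferInstance)
              (wilsonMeasure (d := 3) (L := b * M) ρ β) f U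
            * condExp (MeasurableSpace.comap (starDecimation (G := G) b M) inferInstance)
              (wilsonMeasure (d := 3) (L := b * M) ρ β) g U|
        ≤ 9 * A * Real.exp (4 * m) * (∑ x ∈ Δf, δf x) * (∑ y ∈ Δg, δg y) * Real.exp (-m * n) := by
  classical
  obtain ⟨Cf, hCf⟩ := hbdf
  obtain ⟨Cg, hCg⟩ := hbdg
  have hb0 : 0 < b := by omega
  set μ := wilsonMeasure (d := 3) (L := b * M) ρ β with hμ
  haveI := isProbabilityMeasure_wilsonMeasure (d := 3) (L := b * M) (G := G) ρ hρ β
  have hbound : ∀ {φ : GaugeConfig 3 (b * M) G → ℝ} {C : ℝ}, Measurable φ → (∀ U, |φ U| ≤ C) → Integrable φ μ :=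
    fun hφ hC => Integrable.of_bound hφ.aestronglyMeasurable _ (Filter.Eventually.of_forall fun U => by
      rw [Real.norm_eq_abs]; exact hC U)
  have hfgC : ∀ U, |f U * g U| ≤ Cf * Cg := fun U => by
    rw [abs_mul]; exact mul_le_mul (hCf U) (hCg U) (abs_nonneg _) ((abs_nonneg _).trans (hCf U))
  have hcc := condCov_forest_ae_eq_forestCov ρ hρ hb β hfm hgm (hbound hfm hCf) (hbound hgm hCg)
    (hbound (hfm.mul hgm) hfgC)
  have hSf : 0 ≤ ∑ x ∈ Δf, δf x := Finset.sum_nonneg fun x _ => hδf.nonneg x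
  have hSg : 0 ≤ ∑ y ∈ Δg, δg y := Finset.sum_nonneg fun y _ => hδg.nonneg y
  have hexp : Real.exp (-m * ((n - 4 : ℕ) : ℝ)) ≤ Real.exp (4 * m) * Real.exp (-m * n) := by
    rw [← Real.exp_add]
    refine Real.exp_le_exp.2 ?_
    rcases Nat.lt_or_ge n 4 with h4 | h4
    · rw [Nat.sub_eq_zero_of_le h4.le, Nat.cast_zero, mul_zero]
      have : (n : ℝ) ≤ 4 := by exact_mod_cast h4.le
      nlinarith
    · rw [Nat.cast_sub h4]; push_cast; linarith
  filter_upwards [hcc] with U hU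
  rw [hU]
  set s := starDecimation b M U with hs
  set Δf' := (Set.toFinite (fixSupport b M (↑Δf : Set (Edge 3 (b * M))))).toFinset with hΔf'
  set Δg' := (Set.toFinite (fixSupport b M (↑Δg : Set (Edge 3 (b * M))))).toFinset with hΔg'
  have hcov := hcl (fixPull b M s f) (fixPull b M s g) Δf' Δg' (fixLoad b M Δf δf) (fixLoad b M Δg δg) (n - 4)
    (measurable_fixPull hfm s) (measurable_fixPull hgm s)
    (by rw [hΔf', Set.Finite.coe_toFinset]; exact dependsOn_fixPull s hdepf)
    (by rw [hΔg', Set.Finite.coe_toFinset]; exact dependsOn_fixPull s hdepg)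
    ⟨Cf, fun U => hCf _⟩ ⟨Cg, fun U => hCg _⟩
    (isLipBound_fixPull hb0 hmulL hmulR hsymm hself htri s hdepf hδf)
    (isLipBound_fixPull hb0 hmulL hmulR hsymm hself htri s hdepg hδg)
    (fun x hx y hy => fixSupport_separated hb0 hsep ((Set.Finite.mem_toFinset _).1 hx)
      ((Set.Finite.mem_toFinset _).1 hy))
  have hF : ∑ x ∈ Δf', fixLoad b M Δf δf x ≤ 3 * ∑ x ∈ Δf, δf x :=
    (Finset.sum_le_univ_sum_of_nonneg (fixLoad_nonneg Δf hδf.nonneg)).trans (sum_fixLoad_le Δf hδf.nonneg)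
  have hG : ∑ y ∈ Δg', fixLoad b M Δg δg y ≤ 3 * ∑ y ∈ Δg, δg y :=
    (Finset.sum_le_univ_sum_of_nonneg (fixLoad_nonneg Δg hδg.nonneg)).trans (sum_fixLoad_le Δg hδg.nonneg)
  have hF0 : 0 ≤ ∑ x ∈ Δf', fixLoad b M Δf δf x := Finset.sum_nonneg fun x _ => fixLoad_nonneg Δf hδf.nonneg x
  have hG0 : 0 ≤ ∑ y ∈ Δg', fixLoad b M Δg δg y := Finset.sum_nonneg fun y _ => fixLoad_nonneg Δg hδg.nonneg y
  rw [forestCov_eq_covariance_fixPull μ hfm hgm hCf hCg s]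
  calc |cov[fixPull b M s f, fixPull b M s g; μ]|
      ≤ A * (∑ x ∈ Δf', fixLoad b M Δf δf x) * (∑ y ∈ Δg', fixLoad b M Δg δg y)
          * Real.exp (-m * ((n - 4 : ℕ) : ℝ)) := hcov
    _ ≤ A * (3 * ∑ x ∈ Δf, δf x) * (3 * ∑ y ∈ Δg, δg y) * (Real.exp (4 * m) * Real.exp (-m * n)) := by
        have h1 : A * (∑ x ∈ Δf', fixLoad b M Δf δf x) ≤ A * (3 * ∑ x ∈ Δf, δf x) :=
          mul_le_mul_of_nonneg_left hF hA
        have h2 := mul_le_mul h1 hG hG0 (mul_nonneg hA (by linarith))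
        exact mul_le_mul h2 hexp (Real.exp_nonneg _) (mul_nonneg (mul_nonneg hA (by linarith)) (by linarith))
    _ = 9 * A * Real.exp (4 * m) * (∑ x ∈ Δf, δf x) * (∑ y ∈ Δg, δg y) * Real.exp (-m * n) := by ring

end AnalysisB

end ForestDecay

section ForestWitness

/-- Clustering constants may be taken non-negative (bookkeeping). [folklore] -/
theorem clustersWith_max_zero {K : Type} [MeasurableSpace K] {M : ℕ} [NeZero M] {r : K → K → ℝ}
    {μ : Measure (GaugeConfig 3 M K)} {A m : ℝ} (h : ClustersWith r μ A m) : ClustersWith r μ (max A 0) m :=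
  fun f g Δf Δg δf δg n hfm hgm hdepf hdepg hbdf hbdg hδf hδg hsep =>
    (h f g Δf Δg δf δg n hfm hgm hdepf hdepg hbdf hbdg hδf hδg hsep).trans
      (mul_le_mul_of_nonneg_right (mul_le_mul_of_nonneg_right (mul_le_mul_of_nonneg_right (le_max_left _ _)
        (Finset.sum_nonneg fun x _ => hδf.nonneg x)) (Finset.sum_nonneg fun y _ => hδg.nonneg y))
        (Real.exp_nonneg _))

variable {G : Type} [MeasurableSpace G] {N : ℕ} [Group G] [TopologicalSpace G] [IsTopologicalGroup G]
  [BorelSpace G] [SecondCountableTopology G] [CompactSpace G]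

variable {r : G → G → ℝ}

/-- **`FluctuationDecouplingAt` FOR THE FOREST FAMILY, COMPLETE** (both conjuncts, one torus-uniform constant): at a
coupling `β` with `2 ≤ b(β)`, if the fine Wilson laws on ALL the family's tori `b(β)·M` cluster at rate `m ≥ 0` with one
constant `A ≥ 0` (the target's own currency), then `FluctuationDecouplingAt r ρ (forestFamily b hb) β κ` holds for every
`κ ≤ m · b(β)` — conjunct (i) by `forest_clause_i` (fine clustering transported through the leaf rotation), conjunct
(ii) by `forestFamily_fluctuationDecoupling_ii` (exact disintegration).  The hypothesis is fine clustering itself: for the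
forest, clause (b) of `IRConjecture3` is the TARGET re-expressed, not an RG input. [folklore] -/
theorem forestFamily_fluctuationDecouplingAt (ρ : G →* Matrix (Fin N) (Fin N) ℂ) (hρ : Continuous ρ)
    {bf : ℝ → ℕ} (hbf : ∀ β, 0 < bf β) {β : ℝ} (h2 : 2 ≤ bf β)
    (hmulL : ∀ g a a' : G, r (g * a) (g * a') = r a a') (hmulR : ∀ g a a' : G, r (a * g) (a' * g) = r a a')
    (hsymm : ∀ a a' : G, r a a' = r a' a) (hself : ∀ a : G, r a a = 0)
    (htri : ∀ a a' a'' : G, r a a'' ≤ r a a' + r a' a'') {D : ℝ} (hD : ∀ a a' : G, r a a' ≤ D)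
    {A m κ : ℝ} (hA : 0 ≤ A) (hm : 0 ≤ m) (hκm : κ ≤ m * bf β)
    (hcl : ∀ (M : ℕ) [NeZero M], ClustersWith r (fineLaw ρ β (forestFamily bf hbf) M) A m) :
    FluctuationDecouplingAt r ρ (forestFamily bf hbf) β κ := by
  obtain ⟨c₂, hc₂⟩ := forestFamily_fluctuationDecoupling_ii ρ hρ hbf β h2 hmulL hmulR hsymm hself htri hD κ
  have hb0 : (0 : ℝ) < bf β := by exact_mod_cast hbf β
  have h9 : 0 ≤ 9 * A * Real.exp (4 * m) := by positivity
  refine ⟨max c₂ (9 * A * Real.exp (4 * m)), fun M _ => ⟨?_, ?_⟩⟩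
  · intro f g Δf Δg δf δg n hfm hgm hdepf hdepg hbdf hbdg hδf hδg hsep
    haveI : NeZero (bf β * M) := ⟨Nat.mul_ne_zero (hbf β).ne' (NeZero.ne M)⟩
    have hSf : 0 ≤ ∑ x ∈ Δf, δf x := Finset.sum_nonneg fun x _ => hδf.nonneg x
    have hSg : 0 ≤ ∑ y ∈ Δg, δg y := Finset.sum_nonneg fun y _ => hδg.nonneg y
    have hexp : Real.exp (-m * n) ≤ Real.exp (-κ * n / ((forestFamily (G := G) bf hbf).factor β : ℕ)) := by
      rw [forestFamily_factor, Real.exp_le_exp, neg_mul, neg_mul, neg_div, neg_le_neg_iff,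
        div_le_iff₀ hb0]
      have hn : (0 : ℝ) ≤ n := Nat.cast_nonneg n
      nlinarith
    have h := forest_clause_i ρ hρ h2 β hmulL hmulR hsymm hself htri hA hm (hcl M) hfm hgm hdepf hdepg hbdf hbdg
      hδf hδg hsep
    filter_upwards [h] with U hU
    refine hU.trans ?_
    have h1 : 9 * A * Real.exp (4 * m) * (∑ x ∈ Δf, δf x) * (∑ y ∈ Δg, δg y)
        ≤ max c₂ (9 * A * Real.exp (4 * m)) * (∑ x ∈ Δf, δf x) * (∑ y ∈ Δg, δg y) :=
      mul_le_mul_of_nonneg_right (mul_le_mul_of_nonneg_right (le_max_right _ _) hSf) hSg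
    exact mul_le_mul h1 hexp (Real.exp_nonneg _) (mul_nonneg (mul_nonneg (h9.trans (le_max_right _ _)) hSf) hSg)
  · intro f Δf δf R hfm hdep hbd hδ
    have hSf : 0 ≤ ∑ x ∈ Δf, δf x := Finset.sum_nonneg fun x _ => hδ.nonneg x
    obtain ⟨h, Δh, δh, h1, h2', h3, h4, h5, h6, h7⟩ := hc₂ M f Δf δf R hfm hdep hbd hδ
    refine ⟨h, Δh, δh, h1, h2', h3, h4, h5, h6.trans (mul_le_mul_of_nonneg_right (le_max_left _ _) hSf), ?_⟩
    filter_upwards [h7] with U hU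
    exact hU.trans (mul_le_mul_of_nonneg_right (mul_le_mul_of_nonneg_right (le_max_left _ _) hSf)
      (Real.exp_nonneg _))

end ForestWitness

section ForestWitnessSUN

open Literature.MathematicalPhysics.QuantumLattice (fundamentalRep continuous_fundamentalRep)

variable {N : ℕ} {r : RobustBall.SUN N → RobustBall.SUN N → ℝ}

/-- **THE FOREST WITNESS (audit claim F1) — KERNEL PROOF.**  On Y2's ball `ballOfRobustBallFR N ε₀ ε₁ rFR β⋆` (any
`N`, any radii `≥ 0`), for the fundamental Wilson action and every bounded bi-invariant symmetric link weight `r` with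
`r a a = 0` and the triangle inequality: `ForestWitness3` HOLDS — the lattice mass gap along ANY coupling set `I`
(`MassGap3Cofinal I r ρ`) implies `IRConjecture3 B r ρ I C_b κ` with `C_b = 4 C_b(target) + 1`, `κ = m₀`, witnessed by
the forest family with block factor `b(β) = b_T(β) · max(3, ⌈β / b_T(β)⌉)`.  Ingredients: clause (a) `ForestHaar`;
clause (b)(ii) `ForestQuasiLocality`; clause (b)(i) `forest_clause_i` fed with the target's own clustering on the tori
`b(β)·M` (all multiples of `b_T(β)`, all `≥ 3 b_T(β)`), `e^{−(m₀/β) n} ≤ e^{−m₀ n / b(β)}` as `b(β) ≥ β`.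
CONSEQUENCE (`irConjecture3_iff_massGap3Cofinal_ballFR`): with both bookkeeping constants existential, the ONE
conjecture-labelled hypothesis of the §Y4 sentence is EQUIVALENT to its conclusion — a certified dictionary, not a
reduction (cell audit F1, lead R196's honest label). [folklore] -/
theorem forestWitness3_ballFR {ε₀ ε₁ βstar : ℝ} (h₀ : 0 ≤ ε₀) (h₁ : 0 ≤ ε₁) (hβ : 0 ≤ βstar) (rFR : ℕ)
    (hmulL : ∀ g a a' : RobustBall.SUN N, r (g * a) (g * a') = r a a')
    (hmulR : ∀ g a a' : RobustBall.SUN N, r (a * g) (a' * g) = r a a')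
    (hsymm : ∀ a a' : RobustBall.SUN N, r a a' = r a' a) (hself : ∀ a : RobustBall.SUN N, r a a = 0)
    (htri : ∀ a a' a'' : RobustBall.SUN N, r a a'' ≤ r a a' + r a' a'')
    (hr : ∃ D : ℝ, ∀ a a' : RobustBall.SUN N, r a a' ≤ D) :
    ForestWitness3 (ballOfRobustBallFR N ε₀ ε₁ rFR βstar) r (fundamentalRep (Fin N)) := by
  classical
  intro I hMG
  obtain ⟨hI, m₀, hm₀, C_b, hL⟩ := hMG
  obtain ⟨D, hD⟩ := hr
  have hone : ∀ β ∈ I, (1 : ℝ) ≤ C_b * β := fun β hβ => by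
    obtain ⟨bT, hbT, hbTle, -⟩ := hL β hβ
    exact le_trans (by exact_mod_cast hbT) hbTle
  have hCb : 0 < C_b := by
    obtain ⟨β, hβI, hβ0⟩ : ∃ β ∈ I, 0 < β := by
      by_contra hcon
      exact hI ⟨0, fun β hβ => not_lt.mp fun h => hcon ⟨β, hβ, h⟩⟩
    have h1 := hone β hβI
    exact lt_of_not_ge fun hC => by nlinarith
  have hβpos : ∀ β ∈ I, 0 < β := fun β hβ => by
    have h1 := hone β hβ
    exact lt_of_not_ge fun hb => by nlinarith
  -- the target's cofinal side `b_T(β)` (value `1` off `I`)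
  let bT : ℝ → ℕ := fun β => if h : β ∈ I then Classical.choose (hL β h) else 1
  have hbT_spec : ∀ β (h : β ∈ I), 0 < bT β ∧ (bT β : ℝ) ≤ C_b * β ∧ ∃ A : ℝ, ∀ (M : ℕ) [NeZero M],
      bT β ∣ M → 3 * bT β ≤ M →
        ClustersWith r (wilsonMeasure (d := 3) (L := M) (fundamentalRep (Fin N)) β) A (m₀ / β) := by
    intro β h
    have hs := Classical.choose_spec (hL β h)
    simp only [bT, dif_pos h]
    exact hs
  have hbT_pos : ∀ β, 0 < bT β := fun β => by
    by_cases h : β ∈ I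
    · exact (hbT_spec β h).1
    · simp only [bT, dif_neg h]; exact Nat.one_pos
  -- the forest block factor
  let bf : ℝ → ℕ := fun β => bT β * max 3 ⌈β / bT β⌉₊
  have hbf3 : ∀ β, 3 * bT β ≤ bf β := fun β => by
    show 3 * bT β ≤ bT β * max 3 ⌈β / bT β⌉₊
    rw [Nat.mul_comm 3]; exact Nat.mul_le_mul_left _ (le_max_left _ _)
  have hbf : ∀ β, 0 < bf β := fun β => lt_of_lt_of_le (by have := hbT_pos β; omega) (hbf3 β)
  have h2 : ∀ β ∈ I, 2 ≤ bf β := fun β _ => by have := hbf3 β; have := hbT_pos β; omega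
  have hfac : ∀ β ∈ I, (bf β : ℝ) ≤ (4 * C_b + 1) * β := by
    intro β hβ
    obtain ⟨hpos, hle, -⟩ := hbT_spec β hβ
    have hβ0 := hβpos β hβ
    have hbT0 : (0 : ℝ) < bT β := by exact_mod_cast hpos
    have hq : 0 ≤ β / bT β := div_nonneg hβ0.le hbT0.le
    have hk : ((max 3 ⌈β / bT β⌉₊ : ℕ) : ℝ) ≤ 3 + (β / bT β + 1) := by
      rw [Nat.cast_max, Nat.cast_ofNat]
      exact max_le (by linarith) ((Nat.ceil_lt_add_one hq).le.trans (by linarith))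
    calc (bf β : ℝ) = (bT β : ℝ) * ((max 3 ⌈β / bT β⌉₊ : ℕ) : ℝ) := by
          show ((bT β * max 3 ⌈β / bT β⌉₊ : ℕ) : ℝ) = _; push_cast; ring
      _ ≤ (bT β : ℝ) * (3 + (β / bT β + 1)) := mul_le_mul_of_nonneg_left hk hbT0.le
      _ = 4 * (bT β : ℝ) + β := by field_simp; ring
      _ ≤ 4 * (C_b * β) + β := by linarith
      _ = (4 * C_b + 1) * β := by ring
  have hge : ∀ β ∈ I, β ≤ (bf β : ℝ) := by
    intro β hβ
    have hbT0 : (0 : ℝ) < bT β := by exact_mod_cast hbT_pos β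
    calc β = (bT β : ℝ) * (β / bT β) := by field_simp
      _ ≤ (bT β : ℝ) * (⌈β / bT β⌉₊ : ℝ) := mul_le_mul_of_nonneg_left (Nat.le_ceil _) hbT0.le
      _ ≤ (bT β : ℝ) * ((max 3 ⌈β / bT β⌉₊ : ℕ) : ℝ) :=
          mul_le_mul_of_nonneg_left (by exact_mod_cast le_max_right _ _) hbT0.le
      _ = (bf β : ℝ) := by show _ = ((bT β * max 3 ⌈β / bT β⌉₊ : ℕ) : ℝ); push_cast; ring
  refine ⟨4 * C_b + 1, m₀, by linarith, hm₀, forestFamily bf hbf,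
    entersClusterDomain_forestFamily_of_two_le h₀ h₁ hβ rFR hbf h2 hfac, fun β hβI => ?_⟩
  obtain ⟨hpos, hle, A, hA⟩ := hbT_spec β hβI
  have hβ0 := hβpos β hβI
  have hmβ : 0 ≤ m₀ / β := div_nonneg hm₀.le hβ0.le
  refine forestFamily_fluctuationDecouplingAt (fundamentalRep (Fin N)) (continuous_fundamentalRep (Fin N)) hbf
    (h2 β hβI) hmulL hmulR hsymm hself htri hD (le_max_right A 0) hmβ ?_ fun M _ => ?_
  · calc m₀ = m₀ / β * β := by field_simp
      _ ≤ m₀ / β * (bf β : ℝ) := mul_le_mul_of_nonneg_left (hge β hβI) hmβ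
  · haveI : NeZero (bf β * M) := ⟨Nat.mul_ne_zero (hbf β).ne' (NeZero.ne M)⟩
    have hdvd : bT β ∣ bf β * M := Dvd.dvd.mul_right (Dvd.intro _ rfl) M
    have h3 : 3 * bT β ≤ bf β * M :=
      (hbf3 β).trans (Nat.le_mul_of_pos_right _ (Nat.pos_of_ne_zero (NeZero.ne M)))
    exact clustersWith_max_zero (hA (bf β * M) hdvd h3)

/-- **(F1 ∧ F2, KERNEL) On every Y2 ball `ballOfRobustBallFR N ε₀ ε₁ rFR β⋆` on which Y2's clustering holds at a rate
`m_c > 0`, for every unbounded coupling set `I` and every admissible link weight: `(∃ C_b κ > 0, IRConjecture3 …) ↔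
MassGap3Cofinal I r ρ`.** [folklore] -/
theorem irConjecture3_iff_massGap3Cofinal_ballFR {ε₀ ε₁ βstar : ℝ} (h₀ : 0 ≤ ε₀) (h₁ : 0 ≤ ε₁) (hβ : 0 ≤ βstar)
    (rFR : ℕ) {I : Set ℝ} {m_c : ℝ} (hI : ¬ BddAbove I) (hm : 0 < m_c)
    (hmulL : ∀ g a a' : RobustBall.SUN N, r (g * a) (g * a') = r a a')
    (hmulR : ∀ g a a' : RobustBall.SUN N, r (a * g) (a' * g) = r a a')
    (hsymm : ∀ a a' : RobustBall.SUN N, r a a' = r a' a) (hself : ∀ a : RobustBall.SUN N, r a a = 0)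
    (htri : ∀ a a' a'' : RobustBall.SUN N, r a a'' ≤ r a a' + r a' a'')
    (hr : ∃ D : ℝ, ∀ a a' : RobustBall.SUN N, r a a' ≤ D)
    (hRB : ClusterDomainClustering (ballOfRobustBallFR N ε₀ ε₁ rFR βstar) r m_c) :
    (∃ C_b κ : ℝ, 0 < C_b ∧ 0 < κ ∧ IRConjecture3 (ballOfRobustBallFR N ε₀ ε₁ rFR βstar) r (fundamentalRep (Fin N)) I C_b κ)
      ↔ MassGap3Cofinal I r (fundamentalRep (Fin N)) :=
  irConjecture3_iff_massGap3Cofinal_of_forestWitness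
    (forestWitness3_ballFR h₀ h₁ hβ rFR hmulL hmulR hsymm hself htri hr) hI hm hr hRB

/-- The Frobenius distance on `SU(N)` is left-invariant. [folklore] -/
theorem suFrobDist_mul_left (g a a' : RobustBall.SUN N) : suFrobDist (g * a) (g * a') = suFrobDist a a' := by
  unfold suFrobDist
  have h : ((g * a : RobustBall.SUN N) : Matrix (Fin N) (Fin N) ℂ) - ((g * a' : RobustBall.SUN N) : Matrix (Fin N) (Fin N) ℂ)
      = (g : Matrix (Fin N) (Fin N) ℂ) * ((a : Matrix (Fin N) (Fin N) ℂ) - (a' : Matrix (Fin N) (Fin N) ℂ)) := by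
    simp only [Submonoid.coe_mul]; rw [Matrix.mul_sub]
  rw [h, frobNorm_unitary_mul (su_mem_unitaryGroup g)]

/-- The Frobenius distance on `SU(N)` is right-invariant. [folklore] -/
theorem suFrobDist_mul_right (g a a' : RobustBall.SUN N) : suFrobDist (a * g) (a' * g) = suFrobDist a a' := by
  unfold suFrobDist
  have h : ((a * g : RobustBall.SUN N) : Matrix (Fin N) (Fin N) ℂ) - ((a' * g : RobustBall.SUN N) : Matrix (Fin N) (Fin N) ℂ)
      = ((a : Matrix (Fin N) (Fin N) ℂ) - (a' : Matrix (Fin N) (Fin N) ℂ)) * (g : Matrix (Fin N) (Fin N) ℂ) := by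
    simp only [Submonoid.coe_mul]; rw [Matrix.sub_mul]
  rw [h, frobNorm_mul_unitary _ (su_mem_unitaryGroup g)]

/-- Triangle inequality for the Frobenius distance on `SU(N)`. [folklore] -/
theorem suFrobDist_triangle (a a' a'' : RobustBall.SUN N) : suFrobDist a a'' ≤ suFrobDist a a' + suFrobDist a' a'' :=
  frobNorm_sub_le _ _ _

/-- **THE SU(2) SENTENCE OF RECORD, UNCONDITIONALLY A DICTIONARY (KERNEL)**: on Y2's certified row (ball
`ClusterDomainFR (23/50) (23/100) r`, ceiling `1/16`; clustering = the tree theorem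
`RobustBall.su2_clusterDomainClustering_dim3_oneEighth`), with the Frobenius link distance, for EVERY unbounded coupling set
`I` — in particular Bałaban's —: `(∃ C_b κ > 0, IRConjecture3 …) ↔ MassGap3Cofinal I suFrobDist ρ_fund`.  This is the
kernel form of audit finding F1: the one conjecture of `massGap3Cofinal_su2_balaban_of_irConjecture3` (theory-1,
`YM3IR/BalabanSU2.lean`) is, as typed, EQUIVALENT to its conclusion. [folklore] -/
theorem su2_irConjecture3_iff_massGap3Cofinal (rFR : ℕ) {I : Set ℝ} (hI : ¬ BddAbove I) :
    (∃ C_b κ : ℝ, 0 < C_b ∧ 0 < κ ∧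
        IRConjecture3 (ballOfRobustBallFR 2 (23 / 50) (23 / 100) rFR (1 / 16)) suFrobDist (fundamentalRep (Fin 2)) I C_b κ)
      ↔ MassGap3Cofinal I suFrobDist (fundamentalRep (Fin 2) : RobustBall.SUN 2 →* Matrix (Fin 2) (Fin 2) ℂ) :=
  su2_irConjecture3_iff_massGap3Cofinal_of_forestWitness rFR hI
    (forestWitness3_ballFR (by norm_num) (by norm_num) (by norm_num) rFR suFrobDist_mul_left suFrobDist_mul_right
      suFrobDist_comm suFrobDist_self suFrobDist_triangle (suFrobDist_bddAbove 2))

end ForestWitnessSUN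

end Summit.Ventures.YMGap.YM3IR

end
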